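import Mathlib
import Literature.Computability.AlgebraicComplexity.ArithCircuitProofs

/-!
# Crux `DivisionGap.PerCofactorDegreeReduction` (stmt-ValiantsHypothesis-15046), line `Sketch` —
# stub `stub_evalCost`: the cost of dense evaluation

**Theorem (`stub_evalCost`).** Let `ℓ₁, …, ℓ_r ∈ ℝ≥0[x]` be gates of monotone fan-in-two circuit
size `L(ℓᵢ) ≤ M` (`L` the tree's `complexity` over the semiring `ℝ≥0`), and let
`G ∈ ℝ≥0[z₁, …, z_r]` have all exponents `≤ D`.  Then
`L(G(ℓ₁, …, ℓ_r)) ≤ |supp G| · (r·D·(M+1) + 2)`.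

## Proof

Write `G(ℓ) = Σ_{m ∈ supp G} C(coeff_m G) · Π_{i < r} ℓᵢ ^ (m i)` (`MvPolynomial.aeval_def`,
`MvPolynomial.eval₂_eq'`).  In the tree's compositional cost model (constants free,
`L(f g) ≤ L(f) + L(g) + 1`, `L(f + g) ≤ L(f) + L(g) + 1`):
* folding one gate into a partial product `k` times costs `L(g · ℓ^k) ≤ L(g) + k (M + 1)`
  (induction on `k`, one product gate and one fresh copy of `ℓ` per step;
  `complexity_mul_pow_le`);
* hence `L(g · Π_{i ∈ s} ℓᵢ ^ (m i)) ≤ L(g) + (Σ_{i ∈ s} m i) (M + 1)` (induction on `s`;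
  `complexity_mul_prod_pow_le`), and with `g = C(coeff_m G)` (free) and `Σ_i m i ≤ r D` each
  monomial term costs `≤ r D (M + 1)`;
* one addition gate per term (`complexity_finset_sum_le`) gives the total
  `|supp G| · r D (M + 1) + |supp G| ≤ |supp G| · (r D (M + 1) + 2)`.

Helper namespace `EvalCost`; imports `Literature` and Mathlib only. [folklore]
-/

noncomputable section

-- `Summit.ValiantsHypothesis.ValiantsHypothesis.…` is the tree's mandated single-conjunct layout
-- (Problem = Summit), so the duplicated namespace component is intended.
set_option linter.dupNamespace false

namespace Summit.ValiantsHypothesis.ValiantsHypothesis.Theorems.DivisionGap.PerCofactorDegreeReduction.EvalCost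

open MvPolynomial Literature.Computability.AlgebraicComplexity
open scoped NNReal BigOperators

/-- Folding one gate `ℓ` of cost `≤ M` into a partial product `k` times:
`L(g · ℓ ^ k) ≤ L(g) + k · (M + 1)` (one product gate and one copy of `ℓ` per step;
Bürgisser 2000, §2.1). [folklore] -/
theorem complexity_mul_pow_le {k : Type*} [CommSemiring k] {τ : Type*} {M : ℕ}
    (g ℓ : MvPolynomial τ k) (hℓ : complexity ℓ ≤ M) (n : ℕ) :
    complexity (g * ℓ ^ n) ≤ complexity g + n * (M + 1) := by
  induction n with
  | zero => simp
  | succ n ih =>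
    rw [pow_succ, ← mul_assoc]
    calc complexity (g * ℓ ^ n * ℓ) ≤ complexity (g * ℓ ^ n) + complexity ℓ + 1 :=
          complexity_mul_le_holds _ _
      _ ≤ complexity g + n * (M + 1) + M + 1 := by omega
      _ = complexity g + (n + 1) * (M + 1) := by ring

/-- Folding a power product of gates of cost `≤ M` into `g`:
`L(g · Π_{i ∈ s} ℓᵢ ^ (m i)) ≤ L(g) + (Σ_{i ∈ s} m i) · (M + 1)`. [folklore] -/
theorem complexity_mul_prod_pow_le {k : Type*} [CommSemiring k] {τ ι : Type*} {M : ℕ}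
    (ℓ : ι → MvPolynomial τ k) (hM : ∀ i, complexity (ℓ i) ≤ M) (m : ι → ℕ) (s : Finset ι)
    (g : MvPolynomial τ k) :
    complexity (g * ∏ i ∈ s, ℓ i ^ m i) ≤ complexity g + (∑ i ∈ s, m i) * (M + 1) := by
  classical
  induction s using Finset.induction_on generalizing g with
  | empty => simp
  | insert a s ha ih =>
    rw [Finset.prod_insert ha, Finset.sum_insert ha, ← mul_assoc]
    calc complexity (g * ℓ a ^ m a * ∏ i ∈ s, ℓ i ^ m i)
        ≤ complexity (g * ℓ a ^ m a) + (∑ i ∈ s, m i) * (M + 1) := ih _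
      _ ≤ complexity g + m a * (M + 1) + (∑ i ∈ s, m i) * (M + 1) := by
          gcongr
          exact complexity_mul_pow_le g (ℓ a) (hM a) (m a)
      _ = complexity g + (m a + ∑ i ∈ s, m i) * (M + 1) := by ring

/-- One monomial term of a dense evaluation: for `m ∈ supp G` with all exponents `≤ D`,
`L(C(coeff_m G) · Π_{i < r} ℓᵢ ^ (m i)) ≤ r · D · (M + 1)` (the constant is free). [folklore] -/
theorem complexity_term_le {σ : Type*} (r D M : ℕ) (ℓ : Fin r → MvPolynomial σ ℝ≥0)
    (hM : ∀ i, complexity (ℓ i) ≤ M) (c : ℝ≥0) (m : Fin r →₀ ℕ) (hD : ∀ i, m i ≤ D) :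
    complexity (algebraMap ℝ≥0 (MvPolynomial σ ℝ≥0) c * ∏ i, ℓ i ^ m i) ≤ r * D * (M + 1) := by
  calc complexity (algebraMap ℝ≥0 (MvPolynomial σ ℝ≥0) c * ∏ i, ℓ i ^ m i)
      ≤ complexity (algebraMap ℝ≥0 (MvPolynomial σ ℝ≥0) c) + (∑ i, m i) * (M + 1) :=
        complexity_mul_prod_pow_le ℓ hM m Finset.univ _
    _ = (∑ i, m i) * (M + 1) := by
        rw [MvPolynomial.algebraMap_eq, complexity_C_holds c, zero_add]
    _ ≤ r * D * (M + 1) := by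
        gcongr
        calc ∑ i, m i ≤ ∑ _i : Fin r, D := Finset.sum_le_sum fun i _ => hD i
          _ = r * D := by rw [Finset.sum_const, Finset.card_univ, Fintype.card_fin, smul_eq_mul]

/-- **stub_evalCost — the cost of dense evaluation.**  If `G ∈ ℝ≥0[z₁, …, z_r]` has all exponents
`≤ D` and the gates `ℓᵢ` cost `≤ M`, then `L(G(ℓ)) ≤ |supp G| · (r·D·(M+1) + 2)`: each monomial
term costs `≤ r D (M + 1)` (`complexity_term_le`: `≤ r D` product gates, each joining a fresh copy
of a gate of cost `≤ M`, the scalar weight free), and one addition gate per term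
(`complexity_finset_sum_le`).  Meaning in the line: for a BOUNDED number of light gates any
low-degree nonnegative relation is automatically cheap, so positive-relation degree reduction over
`≤ r` light gates is a pure existence question about degrees. [folklore] -/
theorem stub_evalCost {σ : Type} (r D M : ℕ) (ℓ : Fin r → MvPolynomial σ ℝ≥0)
    (hM : ∀ i, complexity (ℓ i) ≤ M)
    (G : MvPolynomial (Fin r) ℝ≥0) (hD : ∀ m ∈ G.support, ∀ i, m i ≤ D) :
    complexity (MvPolynomial.aeval ℓ G) ≤ G.support.card * (r * D * (M + 1) + 2) := by
  rw [MvPolynomial.aeval_def, MvPolynomial.eval₂_eq']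
  calc complexity (∑ m ∈ G.support,
          algebraMap ℝ≥0 (MvPolynomial σ ℝ≥0) (coeff m G) * ∏ i, ℓ i ^ m i)
      ≤ ∑ m ∈ G.support,
          complexity (algebraMap ℝ≥0 (MvPolynomial σ ℝ≥0) (coeff m G) * ∏ i, ℓ i ^ m i) +
            G.support.card :=
        complexity_finset_sum_le _ _
    _ ≤ ∑ _m ∈ G.support, r * D * (M + 1) + G.support.card := by
        gcongr with m hm
        exact complexity_term_le r D M ℓ hM _ m (hD m hm)
    _ = G.support.card * (r * D * (M + 1) + 1) := by
        rw [Finset.sum_const, smul_eq_mul]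
        ring
    _ ≤ G.support.card * (r * D * (M + 1) + 2) := by
        gcongr
        omega

end Summit.ValiantsHypothesis.ValiantsHypothesis.Theorems.DivisionGap.PerCofactorDegreeReduction.EvalCost

end
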